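/-
Copyright: rh-split cell (screw family, typer seat rh-split-typer-5) gen 0, 2026-08-27.  Splitting search
over kernel-typed RH-equivalences.  A splitting `A ∧ B ⟹ RH` is CONDITIONAL bookkeeping unless `A` and `B`
are both proved; nothing here bears on the truth of RH.
-/
import Summits.RiemannHypothesis.RiemannHypothesis.Theses.ScrewFabry
import Summits.RiemannHypothesis.RiemannHypothesis.Theorems.ScrewFabryFabryBridge
import Summits.RiemannHypothesis.RiemannHypothesis.Theorems.ScrewFabryAssembly
import Summits.RiemannHypothesis.RiemannHypothesis.Theorems.Splittings.ScrewLatticeThinWall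
import Literature.NumberTheory.LFunctions.ZetaScrewThm17Proofs
import HarnessLib

/-!
# ROW X-16 «FABRY EXCHANGE» — `SectorExchange ∧ TW(1) ⟺ RH` given the Fabry–Pólya fact, bookkeeping

Route `ScrewFabry` (L35; planner rh-idea-1 g0, Sketch5.lean `pub/ideators/rh-idea-1/fabry/Sketch5.lean`
sha16 f1d216bf3a20ccff), family #3 of the screw desk (bridge member elect ⊆ X-10, rh-split-ref-2 g6
CENSUS #33; sibling of X-15 «Pringsheim bridge»).  Objects: Suzuki's screw function `Ψ = zetaScrew`, the
aliased pole field `aliasedPoleSet 1 ⊆ 𝔻` of the lattice generating function at step `h = 1`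
(`ScrewLatticeContinuation`), the two-sided lattice ceiling `CEIL(1) = LatticeCeiling 1`, the thin wall
`TW(1) = ThinWall 1` (`ScrewLatticeThinWall`, row X-10), and the route decls
`FabryFact` (the Fabry–Pólya sign-change theorem in segment form — a NAMED PRINT FACT in hypothesis position,
= `Literature.Analysis.Complex.FabrySignChanges` verbatim), `FabryBridge` (item 23056, PROVED:
`Theorems.ScrewFabry.fabryBridge_proof`), `SectorExchange` (item 23057, OPEN, RH-implied: some rate `Δ ≥ 0`
with windowed density `≤ Δ/2` of the negative samples `Ψ(m) < 0` AND a closed wall missing the sector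
`{‖z‖ < 1, |arg z| ≤ πΔ}`), `ThinWallOne` (item 23059 = `ThinWall 1`, OPEN, RH-implied), `Assembly`
(item 23060, PROVED: `Theorems.ScrewFabry.assembly_proof`).

Contents (all by name over landed decls; no analysis is redone here):
1. `latticeCeiling_one_of_fabryFact_of_sectorExchange : FabryFact → SectorExchange → LatticeCeiling 1`
   (= `fabryBridge_proof` at `h = 1` with the rate `Δ` unpacked from `SectorExchange`);
2. `rh_of_fabryFact_of_sectorExchange_of_thinWallOne` (= `assembly_proof` fed with `fabryBridge_proof`);
3. `sectorExchange_of_rh : RH → SectorExchange` (port of Sketch5 `sectorExchange_of_rh`: under RH `Ψ ≥ 0`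
   (`ZetaScrewThm17.zetaScrew_nonneg_of_RH`, Suzuki Thm 1.7) so there are no negative samples, and the
   aliased pole field is empty (`aliasedPoleSet_eq_empty_of_rh`) — rate `Δ = 0`);
4. `thinWallOne_of_rh` (= `ScrewLatticeThinWall.thinWall_of_rh _ 1`);
5. the ROW **`sectorExchange_and_thinWallOne_iff_rh (hF : FabryFact) : SectorExchange ∧ ThinWallOne ↔ RH`**
   (shape of X-10 `latticeCeiling_and_thinWall_iff_rh`, X-11 `latticeCeiling_and_dustWall_iff_rh`).

X-16 is a CONDITIONAL splitting: `⟸` is unconditional, `⟹` is conditional on the print fact `FabryFact`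
(Fabry 1898 / Pólya 1929 / Bieberbach 1955; Eremenko 2008 Thm A) and both conjuncts `SectorExchange`,
`ThinWallOne` are OPEN, RH-implied conjectures that are not claimed here.  RH is not proved by this; nothing
here bears on the truth of RH.  No `sorry`, no new axioms, no definitions, no instances, no notation.
-/

set_option linter.dupNamespace false

namespace Summit.RiemannHypothesis.RiemannHypothesis.Theorems.Splittings.ScrewFabry

open Literature.NumberTheory.LFunctions
open Summit.RiemannHypothesis.RiemannHypothesis.Theorems.Splittings.ScrewLatticeContinuation
open Summit.RiemannHypothesis.RiemannHypothesis.Theorems.Splittings.ScrewLatticeThinWall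
open Summit.RiemannHypothesis.RiemannHypothesis.Theses.ScrewFabry (FabryFact FabryBridge SectorExchange
  ThinWallOne)

/-! ## 1. The conditional direction: `FabryFact ∧ SectorExchange ⟹ CEIL(1)`, `… ∧ TW(1) ⟹ RH` -/

/-- **`FabryFact → SectorExchange → CEIL(1)`**: unpack the rate `Δ ≥ 0` with its Ψ-side windowed-density
clause and its zero-side wall-free sector from `SectorExchange` and apply the landed bridge
`Theorems.ScrewFabry.fabryBridge_proof` (item 23056) at step `h = 1`. -/
theorem latticeCeiling_one_of_fabryFact_of_sectorExchange (hF : FabryFact) (hS : SectorExchange) :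
    LatticeCeiling 1 := by
  obtain ⟨Δ, hΔ, hN, hZ⟩ := hS
  exact Theorems.ScrewFabry.fabryBridge_proof hF 1 one_pos Δ hΔ hN hZ

/-- **`FabryFact → SectorExchange → TW(1) → RH`** — the route's `Assembly` (`Theorems.ScrewFabry.assembly_proof`,
item 23060) fed with the proved bridge `fabryBridge_proof`; equivalently row X-10
`rh_of_latticeCeiling_of_thinWall one_pos` after `latticeCeiling_one_of_fabryFact_of_sectorExchange`. -/
theorem rh_of_fabryFact_of_sectorExchange_of_thinWallOne (hF : FabryFact) (hS : SectorExchange)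
    (hT : ThinWallOne) : RiemannHypothesis :=
  Theorems.ScrewFabry.assembly_proof hF Theorems.ScrewFabry.fabryBridge_proof hS hT

/-! ## 2. The unconditional direction: RH ⟹ both conjuncts -/

/-- **RH ⟹ `SectorExchange`** with rate `Δ = 0`: under RH `Ψ ≥ 0` everywhere (Suzuki 2023 Thm 1.7,
`ZetaScrewThm17.zetaScrew_nonneg_of_RH`), so the set of negative lattice samples in any window is empty and its
count `0 ≤ (0/2 + ε)·(r t)`; and the aliased pole field is empty (`aliasedPoleSet_eq_empty_of_rh`), so its
closure misses every sector.  Port of planner rh-idea-1's Sketch5 `sectorExchange_of_rh`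
(`pub/ideators/rh-idea-1/fabry/Sketch5.lean`, sha16 f1d216bf3a20ccff, ll. 67–77). -/
theorem sectorExchange_of_rh (hRH : RiemannHypothesis) : SectorExchange := by
  refine ⟨0, le_rfl, fun r hr _ ε hε ↦ ⟨1, fun t ht ↦ ?_⟩, fun z _ _ ↦ ?_⟩
  · have hset : {m : ℕ | t < m ∧ (m : ℝ) ≤ (1 + r) * t ∧ zetaScrew (m * (1 : ℝ)) < 0} = ∅ := by
      ext m
      simp only [Set.mem_setOf_eq, Set.mem_empty_iff_false, iff_false, not_and, not_lt]
      exact fun _ _ ↦ ZetaScrewThm17.zetaScrew_nonneg_of_RH hRH _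
    rw [hset, Set.ncard_empty, Nat.cast_zero]
    have : 0 < r * t := mul_pos hr (by linarith)
    positivity
  · rw [aliasedPoleSet_eq_empty_of_rh hRH, closure_empty]
    simp

/-- **RH ⟹ `TW(1)`** (`ThinWallOne = ThinWall 1`), by name from row X-10's `thinWall_of_rh`. -/
theorem thinWallOne_of_rh (hRH : RiemannHypothesis) : ThinWallOne :=
  thinWall_of_rh hRH 1

/-! ## 3. The row -/

/-- **ROW X-16 «FABRY EXCHANGE» (conditional bookkeeping)**: given the Fabry–Pólya print fact `FabryFact`,
`SectorExchange ∧ ThinWallOne ↔ RiemannHypothesis` — the shape of the rows of record X-10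
`ScrewLatticeThinWall.latticeCeiling_and_thinWall_iff_rh` and X-11 `ScrewDust.latticeCeiling_and_dustWall_iff_rh`.
Both conjuncts are OPEN and RH-implied; `FabryFact` is a theorem in print, not yet proved in the tree. -/
theorem sectorExchange_and_thinWallOne_iff_rh (hF : FabryFact) :
    (SectorExchange ∧ ThinWallOne) ↔ RiemannHypothesis :=
  ⟨fun hab ↦ rh_of_fabryFact_of_sectorExchange_of_thinWallOne hF hab.1 hab.2,
    fun hRH ↦ ⟨sectorExchange_of_rh hRH, thinWallOne_of_rh hRH⟩⟩

end Summit.RiemannHypothesis.RiemannHypothesis.Theorems.Splittings.ScrewFabry
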